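import Summits.CriticalPhenomena.Ising3DConformalLimit.Theorems.EnergyNotSigmaSquaredGapForcesFarMergingPromotion

/-!
# SPLIT PACKAGE (carrier skeleton) — crux stmt-CriticalPhenomena-4468 `GapForcesFarMerging`
crux-strategist seat `cstrat-stmt-CriticalPhenomena-4468-s1`, 2026-08-17. NOT a registered line (registration would overwrite the
lead's skeleton of record v3.3); it is the kernel-checked carrier of the route-level split prepared in `SPLIT-PACKAGE.md`:

  GapForcesFarMerging ⇐ IsoscelesReflectionMinors ∧ SinglePinchPositivity ∧ PinchQuasiMultiplicativityDyadic

with the three children in ITEM-READY explicit form (only `criticalCorr`; each is definitionally the corresponding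
`…Shape cc2 (criticalCorr 3 4)` of `Negative.LineShapes` / `Negative.ScaleIterationDyadic`), the two flanking children PROVED from tree
theorems (`rpUnpinchIsoShape_criticalCorr` ← stub_rpUnpinch p74044; `singlePinchPositiveShape_criticalCorr` ← stub_singlePinchPositive
p74075), the one open child `stub_pinchQuasiMultiplicativityDyadic` (= QM-dyadic, ITEM-TEXTS §2) left as the only `sorry`, and the
composition `GapForcesFarMerging_of` concluding the crux BY NAME through the accepted certificate `gapForcesFarMerging_of_three_stubs`
(GAP consumed once in `singlePinchLaw_of_gap_and_isoRP`; soft dyadic scale iteration `scaleIteration_dyadic_criticalCorr`).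
`lean check`: rc 0, sorries = 1 (the open child). Glue twin with all three as hypotheses: `Split.GapForcesFarMerging_of_subs`
(registered stub of 4468, evidence EnergyNotSigmaSquaredGapForcesFarMergingSplit.lean).
-/

noncomputable section

namespace Summit.CriticalPhenomena.Ising3DConformalLimit.Cruxes.GapForcesFarMerging.QmDyadicSplit

open Literature.Probability.LatticeModels
open Summit.CriticalPhenomena.Ising3DConformalLimit.Theses.EnergyNotSigmaSquared
open Summit.CriticalPhenomena.Ising3DConformalLimit.Theorems.GapForcesFarMerging.Negative
open Summit.CriticalPhenomena.Ising3DConformalLimit.EnergyNotSigmaSquaredGapForcesFarMerging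
  (rpUnpinchIsoShape_criticalCorr singlePinchPositiveShape_criticalCorr)

/-- Child 1 (support, PROVED): the isosceles reflection-positivity Gram minors through the site planes `x₀ = m` — far-end
un-pinching; with GAP they give the single-pinch law `𝒜(e₂;m) ≤ C m^{-κ/2}`. [cite: FILS1978, Thm. 2.1] -/
theorem stub_isoscelesReflectionMinors :
    ∀ m : ℕ, 1 ≤ m → (criticalCorr 3 4 ![0, Pi.single 1 1, Pi.single 0 (2 * (m : ℤ)) + Pi.single 1 (m : ℤ), Pi.single 0 (2 * (m : ℤ)) - Pi.single 1 (m : ℤ)] - criticalCorr 3 2 ![0, Pi.single 1 1] * criticalCorr 3 2 ![Pi.single 0 (2 * (m : ℤ)) + Pi.single 1 (m : ℤ), Pi.single 0 (2 * (m : ℤ)) - Pi.single 1 (m : ℤ)]) ^ 2 ≤ (criticalCorr 3 4 ![0, Pi.single 1 1, Pi.single 0 (2 * (m : ℤ)), Pi.single 0 (2 * (m : ℤ)) + Pi.single 1 1] - criticalCorr 3 2 ![0, Pi.single 1 1] * criticalCorr 3 2 ![Pi.single 0 (2 * (m : ℤ)), Pi.single 0 (2 * (m : ℤ)) + Pi.single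 1 1]) * (criticalCorr 3 4 ![Pi.single 1 (m : ℤ), Pi.single 1 (-(m : ℤ)), Pi.single 0 (2 * (m : ℤ)) + Pi.single 1 (m : ℤ), Pi.single 0 (2 * (m : ℤ)) - Pi.single 1 (m : ℤ)] - criticalCorr 3 2 ![Pi.single 1 (m : ℤ), Pi.single 1 (-(m : ℤ))] * criticalCorr 3 2 ![Pi.single 0 (2 * (m : ℤ)) + Pi.single 1 (m : ℤ), Pi.single 0 (2 * (m : ℤ)) - Pi.single 1 (m : ℤ)]) :=
  rpUnpinchIsoShape_criticalCorr

/-- Child 2 (support, PROVED): strict positivity of the single-pinch truncation `T(e₂;m) > 0`, `m ≥ 1`. [folklore] -/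
theorem stub_singlePinchPositivity :
    ∀ m : ℕ, 1 ≤ m → 0 < criticalCorr 3 4 ![0, Pi.single 1 1, Pi.single 0 (2 * (m : ℤ)) + Pi.single 1 (m : ℤ), Pi.single 0 (2 * (m : ℤ)) - Pi.single 1 (m : ℤ)] - criticalCorr 3 2 ![0, Pi.single 1 1] * criticalCorr 3 2 ![Pi.single 0 (2 * (m : ℤ)) + Pi.single 1 (m : ℤ), Pi.single 0 (2 * (m : ℤ)) - Pi.single 1 (m : ℤ)] :=
  singlePinchPositiveShape_criticalCorr

/-- Child 3 (CRUX, OPEN) = QM-dyadic: sub-exponential-defect dyadic one-passage quasi-multiplicativity of the single-pinch avoidance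
functional of the critical correlators of `ℤ³` — the ℤ³-sourced-current analogue of the separation lemma / up-to-constants
quasi-multiplicativity of non-intersection probabilities. The one open analytic core of the crux after eight lead seats.
[cite: Lawler1991, ch. 3–5 (model statement)] -/
theorem stub_pinchQuasiMultiplicativityDyadic :
    ∀ η : ℝ, 0 < η → η < 1 → ∃ ℓ₀ : ℕ, ∀ ℓ : ℕ, ℓ₀ ≤ ℓ → ∃ c : ℝ, η ^ ℓ ≤ c ∧ ∃ i₁ : ℕ, ∀ i : ℕ, i₁ ≤ i → c * ((criticalCorr 3 4 ![0, Pi.single 1 1, Pi.single 0 (2 * ((2 ^ i : ℕ) : ℤ)) + Pi.single 1 ((2 ^ i : ℕ) : ℤ), Pi.single 0 (2 * ((2 ^ i : ℕ) : ℤ)) - Pi.single 1 ((2 ^ i : ℕ) : ℤ)] - criticalCorr 3 2 ![0, Pi.single 1 1] * criticalCorr 3 2 ![Pi.single 0 (2 * ((2 ^ i : ℕ) : ℤ)) + Pi.single 1 ((2 ^ i : ℕ) : ℤ), Pi.single 0 (2 * ((2 ^ i : ℕ) : ℤ)) - Pi.single 1 ((2 ^ i : ℕ) : ℤ)]) / (criticalCorr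 3 2 ![0, Pi.single 0 (2 * ((2 ^ i : ℕ) : ℤ)) - Pi.single 1 ((2 ^ i : ℕ) : ℤ)] * criticalCorr 3 2 ![Pi.single 1 1, Pi.single 0 (2 * ((2 ^ i : ℕ) : ℤ)) + Pi.single 1 ((2 ^ i : ℕ) : ℤ)])) * ((criticalCorr 3 4 ![0, Pi.single 1 ((2 ^ i : ℕ) : ℤ), Pi.single 0 (2 * ((2 ^ (i + ℓ) : ℕ) : ℤ)) + Pi.single 1 ((2 ^ (i + ℓ) : ℕ) : ℤ), Pi.single 0 (2 * ((2 ^ (i + ℓ) : ℕ) : ℤ)) - Pi.single 1 ((2 ^ (i + ℓ) : ℕ) : ℤ)] - criticalCorr 3 2 ![0, Pi.single 1 ((2 ^ i : ℕ) : ℤ)] * criticalCorr 3 2 ![Pi.single 0 (2 * ((2 ^ (i + ℓ) : ℕ) : ℤ)) + Pi.single 1 ((2 ^ (i + ℓ) : ℕ) : ℤ), Pi.single 0 (2 * ((2 ^ (i + ℓ) : ℕ) : ℤ)) - Pi.single 1 ((2 ^ (i + ℓ) : ℕ) : ℤ)]) / (criticalCorr 3 2 ![0, Pi.single 0 (2 *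 ((2 ^ (i + ℓ) : ℕ) : ℤ)) - Pi.single 1 ((2 ^ (i + ℓ) : ℕ) : ℤ)] * criticalCorr 3 2 ![Pi.single 1 ((2 ^ i : ℕ) : ℤ), Pi.single 0 (2 * ((2 ^ (i + ℓ) : ℕ) : ℤ)) + Pi.single 1 ((2 ^ (i + ℓ) : ℕ) : ℤ)])) ≤ ((criticalCorr 3 4 ![0, Pi.single 1 1, Pi.single 0 (2 * ((2 ^ (i + ℓ) : ℕ) : ℤ)) + Pi.single 1 ((2 ^ (i + ℓ) : ℕ) : ℤ), Pi.single 0 (2 * ((2 ^ (i + ℓ) : ℕ) : ℤ)) - Pi.single 1 ((2 ^ (i + ℓ) : ℕ) : ℤ)] - criticalCorr 3 2 ![0, Pi.single 1 1] * criticalCorr 3 2 ![Pi.single 0 (2 * ((2 ^ (i + ℓ) : ℕ) : ℤ)) + Pi.single 1 ((2 ^ (i + ℓ) : ℕ) : ℤ), Pi.single 0 (2 * ((2 ^ (i + ℓ) : ℕ) : ℤ)) - Pi.single 1 ((2 ^ (i + ℓ) : ℕ) : ℤ)]) / (criticalCorr 3 2 ![0, Pi.single 0 (2 * ((2 ^ (i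 + ℓ) : ℕ) : ℤ)) - Pi.single 1 ((2 ^ (i + ℓ) : ℕ) : ℤ)] * criticalCorr 3 2 ![Pi.single 1 1, Pi.single 0 (2 * ((2 ^ (i + ℓ) : ℕ) : ℤ)) + Pi.single 1 ((2 ^ (i + ℓ) : ℕ) : ℤ)])) := by
  sorry

/-- The crux BY NAME from the three children (accepted certificate `gapForcesFarMerging_of_three_stubs`). [folklore] -/
theorem GapForcesFarMerging_of : GapForcesFarMerging :=
  gapForcesFarMerging_of_three_stubs stub_isoscelesReflectionMinors stub_singlePinchPositivity
    stub_pinchQuasiMultiplicativityDyadic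

end Summit.CriticalPhenomena.Ising3DConformalLimit.Cruxes.GapForcesFarMerging.QmDyadicSplit

end
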